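import Literature.Algebra.Semigroups.GreensLemma

/-!
# Group `𝓗`-classes: Green's theorem and the isomorphism of group `𝓗`-classes in a `𝓓`-class

Source: O. Ganyushkin, V. Mazorchuk, *Classical Finite Transformation Semigroups*, Algebra and
Applications 9, Springer (2009) [GanyushkinMazorchuk2009], §4.4 Exercise 4.4.10 and
Theorem 4.4.11 ((c) ⇒ (a), "Green's theorem"), §4.7 Theorem 4.7.5.

Continuation of `Literature.Algebra.Semigroups.GreensLemma`, with the same reading of Green's
relations in a monoid `M` (`a 𝓛 b` iff `(∃ x, a = x * b) ∧ (∃ y, b = y * a)`, `a 𝓡 b` iff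
`(∃ x, a = b * x) ∧ (∃ y, b = a * y)`, `𝓗 = 𝓛 ∩ 𝓡`, `𝓓 = 𝓛 ∘ 𝓡`), and no definitions.

* Exercise 4.4.10: a semigroup in which all translations `x ↦ ax`, `x ↦ xa` are surjective is
  a group (`exists_one_of_mul_surjective`, `exists_inv_of_mul_surjective`);
* Theorem 4.4.11, (c) ⇒ (b): if an `𝓗`-class contains `a`, `b` and `ab`, then it contains an
  idempotent (`exists_idempotent_greenH_of_mul_greenH`) — by Green's lemma all translations
  by elements of the class are bijections of the class (`bijOn_mul_right_greenH`,
  `bijOn_mul_left_greenH`); with `greenH_idempotent_iff` of the previous file this is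
  (c) ⇒ (a): the class is a group;
* Theorem 4.7.5: two group `𝓗`-classes `𝓗(e)`, `𝓗(f)` (`e`, `f` idempotents) inside the same
  `𝓓`-class are isomorphic groups, via `x ↦ a'xa` (`exists_bijOn_mulHom_greenH_of_greenD`).
-/

namespace Literature.Algebra.Semigroups

variable {M : Type*} [Monoid M]

/-! ### Exercise 4.4.10 -/

/-- **Exercise 4.4.10** (identity): in a nonempty semigroup `S` with `aS = Sa = S` for all `a`
there is a two-sided identity. [cite: GanyushkinMazorchuk2009, Exercise 4.4.10] -/
theorem exists_one_of_mul_surjective {S : Type*} [Semigroup S] [Nonempty S]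
    (hl : ∀ a : S, Function.Surjective (a * ·)) (hr : ∀ a : S, Function.Surjective (· * a)) :
    ∃ e : S, ∀ x : S, e * x = x ∧ x * e = x := by
  obtain ⟨a⟩ := ‹Nonempty S›
  obtain ⟨e, he⟩ := hr a a      -- `e a = a`
  obtain ⟨e', he'⟩ := hl a a    -- `a e' = a`
  dsimp only at he he'
  have hle : ∀ x : S, e * x = x := fun x => by
    obtain ⟨z, rfl⟩ := hl a x
    show e * (a * z) = a * z
    rw [← mul_assoc, he]
  have hre : ∀ x : S, x * e' = x := fun x => by
    obtain ⟨z, rfl⟩ := hr a x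
    show z * a * e' = z * a
    rw [mul_assoc, he']
  have hee : e = e' := by rw [← hre e, hle e']
  exact ⟨e, fun x => ⟨hle x, hee ▸ hre x⟩⟩

/-- **Exercise 4.4.10** (inverses): in a semigroup `S` with `aS = Sa = S` for all `a`, with
identity `e`, every element has a two-sided inverse; hence `S` is a group.
[cite: GanyushkinMazorchuk2009, Exercise 4.4.10] -/
theorem exists_inv_of_mul_surjective {S : Type*} [Semigroup S]
    (hl : ∀ a : S, Function.Surjective (a * ·)) (hr : ∀ a : S, Function.Surjective (· * a))
    {e : S} (he : ∀ x : S, e * x = x ∧ x * e = x) (x : S) :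
    ∃ y : S, x * y = e ∧ y * x = e := by
  obtain ⟨y, hy⟩ := hl x e     -- `x y = e`
  obtain ⟨y', hy'⟩ := hr x e   -- `y' x = e`
  dsimp only at hy hy'
  have : y' = y := by
    calc y' = y' * e := ((he y').2).symm
      _ = y' * (x * y) := by rw [← hy]
      _ = y' * x * y := (mul_assoc _ _ _).symm
      _ = e * y := by rw [hy']
      _ = y := (he y).1
  exact ⟨y, hy, this ▸ hy'⟩

/-! ### `𝓗`-classes as sets -/

/-- An `𝓗`-class is determined by any of its elements: if `b 𝓗 a` then `𝓗(b) = 𝓗(a)`.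
[cite: GanyushkinMazorchuk2009, Lemma 4.4.6] -/
theorem greenHClass_eq_of_mem {a b : M}
    (hb : b ∈ {y : M | ((∃ p, y = p * a) ∧ ∃ q, a = q * y) ∧ ((∃ s, y = a * s) ∧ ∃ t, a = y * t)}) :
    {y : M | ((∃ p, y = p * b) ∧ ∃ q, b = q * y) ∧ ((∃ s, y = b * s) ∧ ∃ t, b = y * t)} =
      {y : M | ((∃ p, y = p * a) ∧ ∃ q, a = q * y) ∧ ((∃ s, y = a * s) ∧ ∃ t, a = y * t)} := by
  obtain ⟨hbL, hbR⟩ := hb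
  ext y
  exact ⟨fun ⟨hL, hR⟩ => ⟨greenL_trans hL hbL, greenR_trans hR hbR⟩,
    fun ⟨hL, hR⟩ => ⟨greenL_trans hL (greenL_symm hbL), greenR_trans hR (greenR_symm hbR)⟩⟩

/-! ### Theorem 4.4.11, (c) ⇒ (a): Green's theorem -/

/-- Display (4.5) in the proof of Theorem 4.4.11: if `a`, `x` and `ax` lie in one `𝓗`-class
`H`, then right translation by `x` is a bijection `H → H` (Green's lemma for `a 𝓡 ax`).
[cite: GanyushkinMazorchuk2009, Theorem 4.4.11] -/
theorem bijOn_mul_right_greenH {a x : M}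
    (hax : a * x ∈ {y : M | ((∃ p, y = p * a) ∧ ∃ q, a = q * y) ∧ ((∃ s, y = a * s) ∧ ∃ t, a = y * t)}) :
    Set.BijOn (· * x) {y : M | ((∃ p, y = p * a) ∧ ∃ q, a = q * y) ∧ ((∃ s, y = a * s) ∧ ∃ t, a = y * t)}
      {y : M | ((∃ p, y = p * a) ∧ ∃ q, a = q * y) ∧ ((∃ s, y = a * s) ∧ ∃ t, a = y * t)} := by
  obtain ⟨t, ht⟩ := hax.2.2
  have h := green_lemma_bijOn_H (a := a) (b := a * x) (u := x) (v := t) rfl ht.symm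
  rwa [greenHClass_eq_of_mem hax] at h

/-- Display (4.5), dual form: if `x`, `a` and `xa` lie in one `𝓗`-class `H`, then left
translation by `x` is a bijection `H → H` (dual Green's lemma for `a 𝓛 xa`).
[cite: GanyushkinMazorchuk2009, Theorem 4.4.11] -/
theorem bijOn_mul_left_greenH {a x : M}
    (hxa : x * a ∈ {y : M | ((∃ p, y = p * a) ∧ ∃ q, a = q * y) ∧ ((∃ s, y = a * s) ∧ ∃ t, a = y * t)}) :
    Set.BijOn (x * ·) {y : M | ((∃ p, y = p * a) ∧ ∃ q, a = q * y) ∧ ((∃ s, y = a * s) ∧ ∃ t, a = y * t)}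
      {y : M | ((∃ p, y = p * a) ∧ ∃ q, a = q * y) ∧ ((∃ s, y = a * s) ∧ ∃ t, a = y * t)} := by
  obtain ⟨q, hq⟩ := hxa.1.2
  have h := green_lemma_dual_bijOn_H (a := a) (b := x * a) (u := x) (v := q) rfl hq.symm
  rwa [greenHClass_eq_of_mem hxa] at h

/-- **Theorem 4.4.11**, proof of (c) ⇒ (a): if the `𝓗`-class `H` of `a` contains `b` and `ab`,
then for every `x ∈ H` both translations `y ↦ yx` and `y ↦ xy` are bijections of `H`
(`Hx = xH = H`). [cite: GanyushkinMazorchuk2009, Theorem 4.4.11] -/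
theorem bijOn_translations_of_mul_greenH {a b : M}
    (hb : b ∈ {y : M | ((∃ p, y = p * a) ∧ ∃ q, a = q * y) ∧ ((∃ s, y = a * s) ∧ ∃ t, a = y * t)})
    (hab : a * b ∈ {y : M | ((∃ p, y = p * a) ∧ ∃ q, a = q * y) ∧ ((∃ s, y = a * s) ∧ ∃ t, a = y * t)})
    {x : M} (hx : x ∈ {y : M | ((∃ p, y = p * a) ∧ ∃ q, a = q * y) ∧ ((∃ s, y = a * s) ∧ ∃ t, a = y * t)}) :
    Set.BijOn (· * x) {y : M | ((∃ p, y = p * a) ∧ ∃ q, a = q * y) ∧ ((∃ s, y = a * s) ∧ ∃ t, a = y * t)}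
        {y : M | ((∃ p, y = p * a) ∧ ∃ q, a = q * y) ∧ ((∃ s, y = a * s) ∧ ∃ t, a = y * t)} ∧
      Set.BijOn (x * ·) {y : M | ((∃ p, y = p * a) ∧ ∃ q, a = q * y) ∧ ((∃ s, y = a * s) ∧ ∃ t, a = y * t)}
        {y : M | ((∃ p, y = p * a) ∧ ∃ q, a = q * y) ∧ ((∃ s, y = a * s) ∧ ∃ t, a = y * t)} := by
  -- `aH = H`: `a`, `b`, `ab ∈ H = 𝓗(b)`
  have haL : Set.BijOn (a * ·) {y : M | ((∃ p, y = p * a) ∧ ∃ q, a = q * y) ∧ ((∃ s, y = a * s) ∧ ∃ t, a = y * t)}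
      {y : M | ((∃ p, y = p * a) ∧ ∃ q, a = q * y) ∧ ((∃ s, y = a * s) ∧ ∃ t, a = y * t)} := by
    have hab' : a * b ∈ {y : M | ((∃ p, y = p * b) ∧ ∃ q, b = q * y) ∧ ((∃ s, y = b * s) ∧ ∃ t, b = y * t)} := by
      rw [greenHClass_eq_of_mem hb]; exact hab
    have := bijOn_mul_left_greenH hab'
    rwa [greenHClass_eq_of_mem hb] at this
  have hbR := bijOn_mul_right_greenH hab
  -- for `x ∈ H`: `ax ∈ H` gives `Hx = H`, and `xb ∈ H` gives `xH = H`
  refine ⟨bijOn_mul_right_greenH (haL.mapsTo hx), ?_⟩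
  have hxb : x * b ∈ {y : M | ((∃ p, y = p * b) ∧ ∃ q, b = q * y) ∧ ((∃ s, y = b * s) ∧ ∃ t, b = y * t)} := by
    rw [greenHClass_eq_of_mem hb]; exact hbR.mapsTo hx
  have := bijOn_mul_left_greenH hxb
  rwa [greenHClass_eq_of_mem hb] at this

/-- **Theorem 4.4.11**, (c) ⇒ (b) (hence (c) ⇒ (a) with `greenH_idempotent_iff`): if the
`𝓗`-class `H` of `a` contains `b` and `ab`, then `H` contains an idempotent `e`, which is a
two-sided identity for `H` (so `H = 𝓗(e)` is a group — Exercise 4.4.10).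
[cite: GanyushkinMazorchuk2009, Theorem 4.4.11] -/
theorem exists_idempotent_greenH_of_mul_greenH {a b : M}
    (hb : b ∈ {y : M | ((∃ p, y = p * a) ∧ ∃ q, a = q * y) ∧ ((∃ s, y = a * s) ∧ ∃ t, a = y * t)})
    (hab : a * b ∈ {y : M | ((∃ p, y = p * a) ∧ ∃ q, a = q * y) ∧ ((∃ s, y = a * s) ∧ ∃ t, a = y * t)}) :
    ∃ e ∈ {y : M | ((∃ p, y = p * a) ∧ ∃ q, a = q * y) ∧ ((∃ s, y = a * s) ∧ ∃ t, a = y * t)},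
      e * e = e ∧ ∀ y ∈ {y : M | ((∃ p, y = p * a) ∧ ∃ q, a = q * y) ∧ ((∃ s, y = a * s) ∧ ∃ t, a = y * t)},
        e * y = y ∧ y * e = y := by
  have ha : a ∈ {y : M | ((∃ p, y = p * a) ∧ ∃ q, a = q * y) ∧ ((∃ s, y = a * s) ∧ ∃ t, a = y * t)} :=
    ⟨greenL_refl a, greenR_refl a⟩
  obtain ⟨hRa, hLa⟩ := bijOn_translations_of_mul_greenH hb hab ha
  -- `e a = a` with `e ∈ H`, and `a e' = a` with `e' ∈ H`
  obtain ⟨e, he, hea⟩ := hRa.surjOn ha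
  obtain ⟨e', he', hae'⟩ := hLa.surjOn ha
  have hea : e * a = a := hea
  have hae' : a * e' = a := hae'
  have hle : ∀ y ∈ {y : M | ((∃ p, y = p * a) ∧ ∃ q, a = q * y) ∧ ((∃ s, y = a * s) ∧ ∃ t, a = y * t)}, e * y = y := by
    intro y hy
    obtain ⟨z, -, rfl⟩ := hLa.surjOn hy
    show e * (a * z) = a * z
    rw [← mul_assoc, hea]
  have hre : ∀ y ∈ {y : M | ((∃ p, y = p * a) ∧ ∃ q, a = q * y) ∧ ((∃ s, y = a * s) ∧ ∃ t, a = y * t)}, y * e' = y := by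
    intro y hy
    obtain ⟨z, -, rfl⟩ := hRa.surjOn hy
    show z * a * e' = z * a
    rw [mul_assoc, hae']
  have hee : e = e' := by rw [← hre e he, hle e' he']
  refine ⟨e, he, ?_, fun y hy => ⟨hle y hy, hee ▸ hre y hy⟩⟩
  exact hle e he

/-! ### Theorem 4.7.5: group `𝓗`-classes in one `𝓓`-class are isomorphic -/

/-- **Theorem 4.7.5**: let `e`, `f` be idempotents with `e 𝓓 f` (`𝓓 = 𝓛 ∘ 𝓡`).  Then the group
`𝓗`-classes `𝓗(e)` and `𝓗(f)` are isomorphic: for suitable `a ∈ 𝓡(e) ∩ 𝓛(f)` and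
`a' ∈ 𝓛(e)` with `a'a = f` (and then `aa' = e`), the map `φ(x) = a'xa` is a bijection
`𝓗(e) → 𝓗(f)` with `φ(xy) = φ(x)φ(y)` and `φ(e) = f`.
[cite: GanyushkinMazorchuk2009, Theorem 4.7.5] -/
theorem exists_bijOn_mulHom_greenH_of_greenD {e f : M} (he : e * e = e) (hf : f * f = f)
    (hD : ∃ c, ((∃ x, e = x * c) ∧ ∃ y, c = y * e) ∧ ((∃ x, c = f * x) ∧ ∃ y, f = c * y)) :
    ∃ a a' : M, a * a' = e ∧ a' * a = f ∧
      Set.BijOn (fun x => a' * x * a)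
        {y : M | ((∃ p, y = p * e) ∧ ∃ q, e = q * y) ∧ ((∃ s, y = e * s) ∧ ∃ t, e = y * t)}
        {y : M | ((∃ p, y = p * f) ∧ ∃ q, f = q * y) ∧ ((∃ s, y = f * s) ∧ ∃ t, f = y * t)} ∧
      a' * e * a = f ∧
      ∀ x ∈ {y : M | ((∃ p, y = p * e) ∧ ∃ q, e = q * y) ∧ ((∃ s, y = e * s) ∧ ∃ t, e = y * t)},
        ∀ y ∈ {y : M | ((∃ p, y = p * e) ∧ ∃ q, e = q * y) ∧ ((∃ s, y = e * s) ∧ ∃ t, e = y * t)},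
          a' * (x * y) * a = (a' * x * a) * (a' * y * a) := by
  -- `a ∈ 𝓡(e) ∩ 𝓛(f)` by Lemma 4.4.4
  obtain ⟨a, haR, haL⟩ := (greenL_comp_greenR_iff e f).1 hD
  obtain ⟨⟨t, ht⟩, ⟨s, hs⟩⟩ := haR      -- `e = a t`, `a = e s`
  obtain ⟨⟨p, hp⟩, ⟨q, hq⟩⟩ := haL      -- `a = p f`, `f = q a`
  have hea : e * a = a := by rw [hs, ← mul_assoc, he]
  have haf : a * f = a := by rw [hp, mul_assoc, hf]
  -- Green's lemma: `x ↦ xa` is a bijection `𝓛(e) → 𝓛(a)`, and `f ∈ 𝓛(a)`; pick `a'` with `a'a = f`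
  have hfL : f ∈ {y : M | (∃ p, y = p * a) ∧ ∃ q, a = q * y} := ⟨⟨q, hq⟩, ⟨p, hp⟩⟩
  obtain ⟨a', ha'L, ha'a⟩ := (green_lemma_bijOn_L hea ht.symm).surjOn hfL
  have ha'a : a' * a = f := ha'a
  obtain ⟨⟨p', hp'⟩, -⟩ := id ha'L
  have ha'e : a' * e = a' := by rw [hp', mul_assoc, he]
  -- `aa' = e`
  have haa' : a * a' = e := by
    calc a * a' = a * (a' * e) := by rw [ha'e]
      _ = a * a' * (a * t) := by rw [← ht, mul_assoc]
      _ = a * (a' * a) * t := by simp only [mul_assoc]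
      _ = a * t := by rw [ha'a, haf]
      _ = e := ht.symm
  refine ⟨a, a', haa', ha'a, ?_, by rw [ha'e, ha'a], ?_⟩
  · -- `φ = μ_{a'} ∘ λ_a : 𝓗(e) → 𝓗(a) → 𝓗(f)`
    have h1 := green_lemma_bijOn_H (a := e) (b := a) (u := a) (v := t) hea ht.symm
    have h2 := green_lemma_dual_bijOn_H (a := a) (b := f) (u := a') (v := p) ha'a hp.symm
    have h12 := h2.comp h1
    have hEq : Set.EqOn ((a' * ·) ∘ (· * a)) (fun x => a' * x * a)
        {y : M | ((∃ p, y = p * e) ∧ ∃ q, e = q * y) ∧ ((∃ s, y = e * s) ∧ ∃ t, e = y * t)} := fun x _ => by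
      show a' * (x * a) = a' * x * a
      rw [mul_assoc]
    exact hEq.bijOn_iff.1 h12
  · rintro x - y ⟨-, ⟨s', hs'⟩, -⟩
    -- `e y = y`
    have hey : e * y = y := by rw [hs', ← mul_assoc, he]
    calc a' * (x * y) * a = a' * (x * (e * y)) * a := by rw [hey]
      _ = a' * (x * (a * a' * y)) * a := by rw [haa']
      _ = (a' * x * a) * (a' * y * a) := by simp only [mul_assoc]

end Literature.Algebra.Semigroups
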